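import Summits.QuantumFields.YangMills.Theorems.BalabanLadderIRAfOnsetCovariance

/-!
# Crux `IR` (stmt-QuantumFields-19354), line `af-pincer`, stub `stub_afOnsetUc : AFToOnsetUKPc` (X-side):
# `Q2 = O((log β)²/β²)` at every unit, uniformly in the torus — the X-clause up to polynomially growing onsets (part 3/3)

Sequel of `Theorems/BalabanLadderIRAfOnsetCovariance` (seat ym-19354-afpincer-s2).

* §4 `exists_sum_abs_schwartz_lattice_le_div_min` (`Σ_{x ∈ T} |f(s x)| ≤ K_f / min(s,1)⁴`, any `s > 0`),
  **`exists_abs_Q2_le_log_sq`**: `|Q2 G r β L s f g| ≤ K (1 + log β)² / (β² · min(s,1)⁸)` for `L ≥ 1`, `β ≥ 1`, `s > 0`.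
* §5 `exists_beta_forall_abs_Q2_le` — at units bounded below, `Q2 → 0` as `β → ∞` uniformly in `L ≥ 1` (ANY test
  functions); **`afToOnset_clause_of_polyOnset`** — for ANY onset function `b⋆ : ℝ → ℕ` with
  `b⋆(β)⁴ · (1 + log β) ≤ C₀ β` on a tail, the X-clause `∃ T β₁, ∀ β ≥ β₁, ∀ s > 0, T ≤ s · b⋆ β → ∃ᶠ L, |Q2 …| ≤ η` HOLDS
  (witness `T = max 1 (K C₀²/η)`).  Read with `b⋆ β = AfPincerUc.mixOnsetUc r.ρ β n ε δ`: **`AFToOnsetUKPc` has content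
  only on tails where `b⋆^c(β)⁴ · log β / β` is unbounded** — an onset growing faster than `(β / log β)^{1/4}` (the
  intended world has `b⋆^c ≍ ξ ≍ e^{cβ}`; there the stub is «mixing follows interaction», owner `XT-ANATOMY-g27.md`,
  not claimed here).  Together with `AfOnset.afToOnset_clause_of_bddOnset` (bounded onsets) this boxes the stub's open
  content into the regime `(β/log β)^{1/4} ≪ b⋆^c(β) < ∞`.

HONEST FRAMING.  Elementary given parts 1–2; one open stub of one open gap-crux of a CONDITIONAL chain; not a gap claim.
-/

set_option autoImplicit false

noncomputable section

open MeasureTheory Filter Topology Finset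
open scoped BigOperators SchwartzMap
open Literature.MathematicalPhysics.QuantumFieldTheory hiding ZdEdge
open Literature.MathematicalPhysics.QuantumLattice
open Literature.Probability.LatticeModels (Site box mem_box)
open Summit.QuantumFields.YangMills.Cruxes.OSLegsFromFemtoAndGap.DlrCollarTransfer
open Summit.QuantumFields.YangMills.Theorems.OSLegsFromFemtoAndGap (sum_decay_le summable_inv_succ_sq
  mul_norm_le_norm_smul_siteToE)

namespace Summit.QuantumFields.YangMills.Cruxes.IR.AfOnset

/-! ## §4 `Q2` at weak coupling: `O((log β)²/β²)` uniformly in the torus, at every unit -/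
section Q2Weak

variable {G : Type} [Group G] [TopologicalSpace G] [IsTopologicalGroup G] [CompactSpace G]
  [MeasurableSpace G] [BorelSpace G] (r : LatticeRep G)

omit [IsTopologicalGroup G] [CompactSpace G] [BorelSpace G] in
/-- **Schwartz weights on the lattice of ANY unit `s > 0`**: `Σ_{x ∈ T} |f(s x)| ≤ K_f / min(s,1)⁴` for every finite
`T ⊆ ℤ⁴` (the estimate inside the tree's `InfiniteVolume.summable_abs_schwartz_lattice`, made quantitative: decay of
order 6 and the Riemann-sum bound `sum_decay_le` at `a = min(s,1)`). [folklore] -/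
theorem exists_sum_abs_schwartz_lattice_le_div_min (f : 𝓢((EuclideanSpace ℝ (Fin 4)), ℝ)) :
    ∃ K : ℝ, 0 ≤ K ∧ ∀ s : ℝ, 0 < s → ∀ T : Finset (Site 4),
      ∑ x ∈ T, |f (s • siteToE x)| ≤ K / (min s 1) ^ 4 := by
  set M : ℝ := 2 ^ (6, 0).1 * (Finset.Iic (6, 0)).sup (fun m => SchwartzMap.seminorm ℝ m.1 m.2) f with hM
  have hM0 : 0 ≤ M := by positivity
  set Z : ℝ := 81 * ∑' m : ℕ, (((m : ℝ) + 1) ^ 2)⁻¹ with hZ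
  have hZ0 : 0 ≤ Z := by
    have : 0 ≤ ∑' m : ℕ, (((m : ℝ) + 1) ^ 2)⁻¹ := tsum_nonneg fun m => by positivity
    positivity
  have hdecay : ∀ y : (EuclideanSpace ℝ (Fin 4)), |f y| ≤ M * ((1 + ‖y‖) ^ 6)⁻¹ := by
    intro y
    have h := SchwartzMap.one_add_le_sup_seminorm_apply (𝕜 := ℝ) (m := (6, 0)) (k := 6) (n := 0)
      le_rfl le_rfl f y
    rw [norm_iteratedFDeriv_zero, Real.norm_eq_abs] at h
    have hpos : 0 < (1 + ‖y‖) ^ 6 := by positivity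
    rw [← div_eq_mul_inv, le_div_iff₀ hpos, mul_comm]
    exact h
  refine ⟨M * Z, mul_nonneg hM0 hZ0, fun s hs T => ?_⟩
  set s' : ℝ := min s 1 with hs'
  have hs'0 : 0 < s' := lt_min hs one_pos
  have hs'1 : s' ≤ 1 := min_le_right _ _
  have hs's : s' ≤ s := min_le_left _ _
  have hcmp : ∀ x : Site 4, |f (s • siteToE x)| ≤ M / s' ^ 4 * (s' ^ 4 * ((1 + s' * ‖x‖) ^ 6)⁻¹) := by
    intro x
    have h1 := hdecay (s • siteToE x)
    have h2 : s' * ‖x‖ ≤ ‖s • siteToE x‖ :=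
      (mul_le_mul_of_nonneg_right hs's (norm_nonneg _)).trans (mul_norm_le_norm_smul_siteToE hs.le x)
    have h3 : ((1 + ‖s • siteToE x‖) ^ 6)⁻¹ ≤ ((1 + s' * ‖x‖) ^ 6)⁻¹ := by
      have : 0 < (1 + s' * ‖x‖) ^ 6 := by positivity
      exact inv_anti₀ this (pow_le_pow_left₀ (by positivity) (by linarith) 6)
    calc |f (s • siteToE x)| ≤ M * ((1 + ‖s • siteToE x‖) ^ 6)⁻¹ := h1
      _ ≤ M * ((1 + s' * ‖x‖) ^ 6)⁻¹ := mul_le_mul_of_nonneg_left h3 hM0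
      _ = M / s' ^ 4 * (s' ^ 4 * ((1 + s' * ‖x‖) ^ 6)⁻¹) := by
          field_simp
  calc ∑ x ∈ T, |f (s • siteToE x)| ≤ ∑ x ∈ T, M / s' ^ 4 * (s' ^ 4 * ((1 + s' * ‖x‖) ^ 6)⁻¹) :=
        Finset.sum_le_sum fun x _ => hcmp x
    _ = M / s' ^ 4 * ∑ x ∈ T, s' ^ 4 * ((1 + s' * ‖x‖) ^ 6)⁻¹ := by rw [Finset.mul_sum]
    _ ≤ M / s' ^ 4 * Z := mul_le_mul_of_nonneg_left (sum_decay_le hs'0 hs'1 (p := 6) le_rfl T) (by positivity)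
    _ = M * Z / s' ^ 4 := by ring

/-- **`Q2` at weak coupling, every unit, every odd torus**: for a lattice representation `r` and test functions `f, g`
there is `K ≥ 0` with `|Q2 G r β L s f g| ≤ K (1 + log β)² / (β² · min(s,1)⁸)` for all `L ≥ 1`, `β ≥ 1`, `s > 0`
(`|Q2| ≤ (Σ|f(s x)|)(Σ|g(s y)|) · sup |Cov|` and §3, §4). [folklore] -/
theorem exists_abs_Q2_le_log_sq (f g : 𝓢((EuclideanSpace ℝ (Fin 4)), ℝ)) :
    ∃ K : ℝ, 0 ≤ K ∧ ∀ (L : ℕ), 1 ≤ L → ∀ β : ℝ, 1 ≤ β → ∀ s : ℝ, 0 < s →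
      |Q2 G r β L s f g| ≤ K * (1 + Real.log β) ^ 2 / (β ^ 2 * (min s 1) ^ 8) := by
  classical
  obtain ⟨W, hW0, hW⟩ := exists_abs_torusCov_dens_le r
  obtain ⟨Kf, hKf0, hKf⟩ := exists_sum_abs_schwartz_lattice_le_div_min f
  obtain ⟨Kg, hKg0, hKg⟩ := exists_sum_abs_schwartz_lattice_le_div_min g
  refine ⟨Kf * Kg * W, by positivity, fun L hL β hβ s hs => ?_⟩
  have hβ0 : 0 < β := lt_of_lt_of_le one_pos hβ
  have hs'0 : 0 < min s 1 := lt_min hs one_pos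
  set w : ℝ := W * (1 + Real.log β) ^ 2 / β ^ 2 with hw
  have hw0 : 0 ≤ w := by positivity
  have hterm : ∀ x ∈ box 4 L, ∀ y ∈ box 4 L,
      |f (s • siteToE x) * g (s • siteToE y) *
        (torusE G r β L (fun U => dens G r x U * dens G r y U) -
          torusE G r β L (dens G r x) * torusE G r β L (dens G r y))| ≤
      |f (s • siteToE x)| * |g (s • siteToE y)| * w := by
    intro x _ y _
    rw [abs_mul, abs_mul]
    exact mul_le_mul_of_nonneg_left (hW L hL β hβ x y) (mul_nonneg (abs_nonneg _) (abs_nonneg _))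
  have hF : ∑ x ∈ box 4 L, |f (s • siteToE x)| ≤ Kf / (min s 1) ^ 4 := hKf s hs _
  have hGs : ∑ y ∈ box 4 L, |g (s • siteToE y)| ≤ Kg / (min s 1) ^ 4 := hKg s hs _
  have hFn : 0 ≤ ∑ x ∈ box 4 L, |f (s • siteToE x)| := Finset.sum_nonneg fun _ _ => abs_nonneg _
  have hGn : 0 ≤ ∑ y ∈ box 4 L, |g (s • siteToE y)| := Finset.sum_nonneg fun _ _ => abs_nonneg _
  unfold Q2
  calc |∑ x ∈ box 4 L, ∑ y ∈ box 4 L, f (s • siteToE x) * g (s • siteToE y) *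
          (torusE G r β L (fun U => dens G r x U * dens G r y U) -
            torusE G r β L (dens G r x) * torusE G r β L (dens G r y))|
      ≤ ∑ x ∈ box 4 L, |∑ y ∈ box 4 L, f (s • siteToE x) * g (s • siteToE y) *
          (torusE G r β L (fun U => dens G r x U * dens G r y U) -
            torusE G r β L (dens G r x) * torusE G r β L (dens G r y))| :=
        Finset.abs_sum_le_sum_abs _ _
    _ ≤ ∑ x ∈ box 4 L, ∑ y ∈ box 4 L, |f (s • siteToE x) * g (s • siteToE y) *
          (torusE G r β L (fun U => dens G r x U * dens G r y U) -
            torusE G r β L (dens G r x) * torusE G r β L (dens G r y))| :=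
        Finset.sum_le_sum fun x _ => Finset.abs_sum_le_sum_abs _ _
    _ ≤ ∑ x ∈ box 4 L, ∑ y ∈ box 4 L, |f (s • siteToE x)| * |g (s • siteToE y)| * w :=
        Finset.sum_le_sum fun x hx => Finset.sum_le_sum fun y hy => hterm x hx y hy
    _ = (∑ x ∈ box 4 L, |f (s • siteToE x)|) * (∑ y ∈ box 4 L, |g (s • siteToE y)|) * w := by
        rw [Finset.sum_mul_sum, Finset.sum_mul]
        refine Finset.sum_congr rfl fun x _ => ?_
        rw [Finset.sum_mul]
    _ ≤ (Kf / (min s 1) ^ 4) * (Kg / (min s 1) ^ 4) * w := by gcongr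
    _ = Kf * Kg * W * (1 + Real.log β) ^ 2 / (β ^ 2 * (min s 1) ^ 8) := by
        rw [hw]
        field_simp

end Q2Weak

/-! ## §5 Consequences for the X-stub: `β → ∞` at units bounded below, and polynomially growing onsets -/
section Consequences

variable {G : Type} [Group G] [TopologicalSpace G] [IsTopologicalGroup G] [CompactSpace G]
  [MeasurableSpace G] [BorelSpace G] (r : LatticeRep G)

/-- **At units bounded below `Q2 → 0` as `β → ∞`, uniformly in the odd torus**: for `s₁ > 0` and `η > 0` there is
`β₁ ≥ 1` with `|Q2 G r β L s f g| ≤ η` for all `β ≥ β₁`, all `L ≥ 1`, all `s ≥ s₁`. [folklore] -/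
theorem exists_beta_forall_abs_Q2_le (f g : 𝓢((EuclideanSpace ℝ (Fin 4)), ℝ)) {s₁ : ℝ} (hs₁ : 0 < s₁) {η : ℝ}
    (hη : 0 < η) :
    ∃ β₁ : ℝ, 1 ≤ β₁ ∧ ∀ β : ℝ, β₁ ≤ β → ∀ (L : ℕ), 1 ≤ L → ∀ s : ℝ, s₁ ≤ s → |Q2 G r β L s f g| ≤ η := by
  obtain ⟨K, hK0, hK⟩ := exists_abs_Q2_le_log_sq r f g
  have hm0 : 0 < min s₁ 1 := lt_min hs₁ one_pos
  set m8 : ℝ := (min s₁ 1) ^ 8 with hm8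
  have hm80 : 0 < m8 := pow_pos hm0 8
  refine ⟨max 1 (4 * K / (η * m8) + 1), le_max_left _ _, fun β hβ L hL s hs => ?_⟩
  have hβ1 : 1 ≤ β := le_trans (le_max_left _ _) hβ
  have hβ0 : 0 < β := lt_of_lt_of_le one_pos hβ1
  have hβK : 4 * K / (η * m8) < β := by
    have := le_trans (le_max_right _ _) hβ
    linarith
  have hs0 : 0 < s := lt_of_lt_of_le hs₁ hs
  have hmin : min s₁ 1 ≤ min s 1 := min_le_min hs le_rfl
  have hmin8 : m8 ≤ (min s 1) ^ 8 := pow_le_pow_left₀ hm0.le hmin 8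
  have hℓ := one_add_log_sq_le hβ1
  refine (hK L hL β hβ1 s hs0).trans ?_
  calc K * (1 + Real.log β) ^ 2 / (β ^ 2 * (min s 1) ^ 8)
      ≤ K * (4 * β) / (β ^ 2 * m8) := by
        gcongr
    _ = (4 * K / (η * m8)) * (η / β) := by
        field_simp
    _ ≤ β * (η / β) := mul_le_mul_of_nonneg_right hβK.le (by positivity)
    _ = η := by field_simp

/-- **Polynomially growing onsets ⟹ the X-clause.**  For ANY onset function `b⋆ : ℝ → ℕ` with
`b⋆(β)⁴ · (1 + log β) ≤ C₀ β` on a tail `[β₀, ∞)`, all test functions `f, g` and every `η > 0` there are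
`T, β₁` such that `β ≥ β₁`, `s > 0` and `T ≤ s · b⋆ β` force `|Q2 G r β L s f g| ≤ η` frequently (indeed for every
`L ≥ 1`).  Witness `T = max 1 (K C₀²/η)`: at `s ≥ 1` use `|Q2| ≤ 4K/β`; at `s < 1`, `T ≤ s b⋆` and the growth bound
give `T⁸ (1 + log β)² ≤ C₀² β² s⁸`, so `K (1 + log β)²/(β² s⁸) ≤ K C₀²/T⁸ ≤ η`.  With `f = θv`, `g = v` this is the
shape of `AfPincerUc.AFToOnsetUKPc` after its outer binders (`b⋆ β = mixOnsetUc r.ρ β n ε δ`): the stub has content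
only where `b⋆^c(β)⁴ log β / β` is unbounded. [folklore] -/
theorem afToOnset_clause_of_polyOnset (bstar : ℝ → ℕ) {C₀ β₀ : ℝ}
    (hgrowth : ∀ β : ℝ, β₀ ≤ β → ((bstar β : ℕ) : ℝ) ^ 4 * (1 + Real.log β) ≤ C₀ * β)
    (f g : 𝓢((EuclideanSpace ℝ (Fin 4)), ℝ)) {η : ℝ} (hη : 0 < η) :
    ∃ T β₁ : ℝ, ∀ β : ℝ, β₁ ≤ β → ∀ s : ℝ, 0 < s → T ≤ s * ((bstar β : ℕ) : ℝ) →
      ∃ᶠ (L : ℕ) in atTop, |Q2 G r β L s f g| ≤ η := by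
  obtain ⟨K, hK0, hK⟩ := exists_abs_Q2_le_log_sq r f g
  set T : ℝ := max 1 (K * C₀ ^ 2 / η) with hTdef
  have hT1 : 1 ≤ T := le_max_left _ _
  have hT0 : 0 < T := lt_of_lt_of_le one_pos hT1
  refine ⟨T, max (max 1 β₀) (4 * K / η + 1), fun β hβ s hs hTs => ?_⟩
  have hβ1 : 1 ≤ β := le_trans (le_trans (le_max_left _ _) (le_max_left _ _)) hβ
  have hβ₀ : β₀ ≤ β := le_trans (le_trans (le_max_right _ _) (le_max_left _ _)) hβ
  have hβK : 4 * K / η < β := by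
    have := le_trans (le_max_right _ _) hβ
    linarith
  have hβ0 : 0 < β := lt_of_lt_of_le one_pos hβ1
  have hℓ0 : 1 ≤ 1 + Real.log β := by linarith [Real.log_nonneg hβ1]
  have hℓsq := one_add_log_sq_le hβ1
  have key : ∀ L : ℕ, 1 ≤ L → |Q2 G r β L s f g| ≤ η := by
    intro L hL
    refine (hK L hL β hβ1 s hs).trans ?_
    by_cases hs1 : 1 ≤ s
    · rw [min_eq_right hs1, one_pow, mul_one, div_le_iff₀ (pow_pos hβ0 2)]
      calc K * (1 + Real.log β) ^ 2 ≤ K * (4 * β) := mul_le_mul_of_nonneg_left hℓsq hK0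
        _ = (4 * K / η) * (η * β) := by field_simp
        _ ≤ β * (η * β) := mul_le_mul_of_nonneg_right hβK.le (by positivity)
        _ = η * β ^ 2 := by ring
    · have hs1' : s ≤ 1 := (not_le.1 hs1).le
      rw [min_eq_left hs1']
      have hsb0 : 0 ≤ s * ((bstar β : ℕ) : ℝ) := by positivity
      have h4 : T ^ 4 ≤ (s * ((bstar β : ℕ) : ℝ)) ^ 4 := pow_le_pow_left₀ hT0.le hTs 4
      have hg := hgrowth β hβ₀
      have h5 : T ^ 4 * (1 + Real.log β) ≤ C₀ * β * s ^ 4 := by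
        calc T ^ 4 * (1 + Real.log β) ≤ (s * ((bstar β : ℕ) : ℝ)) ^ 4 * (1 + Real.log β) :=
              mul_le_mul_of_nonneg_right h4 (by linarith)
          _ = s ^ 4 * (((bstar β : ℕ) : ℝ) ^ 4 * (1 + Real.log β)) := by ring
          _ ≤ s ^ 4 * (C₀ * β) := mul_le_mul_of_nonneg_left hg (by positivity)
          _ = C₀ * β * s ^ 4 := by ring
      have h6 : (T ^ 4 * (1 + Real.log β)) ^ 2 ≤ (C₀ * β * s ^ 4) ^ 2 :=
        pow_le_pow_left₀ (by positivity) h5 2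
      have hT8 : K * C₀ ^ 2 / η ≤ T ^ 8 := (le_max_right _ _).trans (le_self_pow₀ hT1 (by norm_num))
      have hTpos : 0 < T ^ 8 := by positivity
      rw [div_le_iff₀ (by positivity)]
      have h7 : K * (1 + Real.log β) ^ 2 * T ^ 8 ≤ K * (C₀ ^ 2 * β ^ 2 * s ^ 8) := by
        have hre : (1 + Real.log β) ^ 2 * T ^ 8 = (T ^ 4 * (1 + Real.log β)) ^ 2 := by ring
        calc K * (1 + Real.log β) ^ 2 * T ^ 8 = K * ((T ^ 4 * (1 + Real.log β)) ^ 2) := by rw [mul_assoc, hre]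
          _ ≤ K * ((C₀ * β * s ^ 4) ^ 2) := mul_le_mul_of_nonneg_left h6 hK0
          _ = K * (C₀ ^ 2 * β ^ 2 * s ^ 8) := by ring
      have h8 : K * C₀ ^ 2 ≤ η * T ^ 8 := by
        have := mul_le_mul_of_nonneg_left hT8 hη.le
        rwa [mul_div_cancel₀ _ (ne_of_gt hη)] at this
      have h9 : K * (1 + Real.log β) ^ 2 * T ^ 8 ≤ η * (β ^ 2 * s ^ 8) * T ^ 8 := by
        calc K * (1 + Real.log β) ^ 2 * T ^ 8 ≤ K * (C₀ ^ 2 * β ^ 2 * s ^ 8) := h7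
          _ = (K * C₀ ^ 2) * (β ^ 2 * s ^ 8) := by ring
          _ ≤ (η * T ^ 8) * (β ^ 2 * s ^ 8) := mul_le_mul_of_nonneg_right h8 (by positivity)
          _ = η * (β ^ 2 * s ^ 8) * T ^ 8 := by ring
      exact le_of_mul_le_mul_right h9 hTpos
  exact ((eventually_ge_atTop 1).mono fun L hL => key L hL).frequently

end Consequences

end Summit.QuantumFields.YangMills.Cruxes.IR.AfOnset

end
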